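import Summits.Ventures.HSemireg.AmplificationChainSiegel
import Summits.Ventures.HSemireg.PerfectComplexRankDoor
import Summits.Ventures.HSemireg.MarkmanKappaShape
import Summits.Ventures.HSemireg.Transfer
import HarnessLib

/-!
# Venture HSemireg — route (C) at g = 4: the amplification chain instantiated at the PERFECT-COMPLEX door
# («Weil classes are algebraic on every abelian fourfold of the split `ℚ(√-d)`-Weil component, GIVEN the typed transfer
# schema for admissible perfect complexes and ONE admissible complex with Markman's Chern character on ONE split CM anchor»)

HONEST FRAMING. Lean index of the computation cell `pub-hsemireg` (seat p7, assembly). NOTHING about any explicit variety is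
asserted; every published input and every cell assumption is a hypothesis BY NAME; nothing here says HC, HC_CM or HC_AV is
proved. Abelian fourfolds of split Weil type are algebraic IN PRINT (E. Markman, J. Eur. Math. Soc. 25 (2023); C. Schoen for
`ℚ(√-3)`): this file RE-DERIVES that case as a kernel implication from named hypotheses. No `sorry`, no new axiom, NO definition.

## What is composed (all three inputs are other seats' declarations, cited BY NAME)

* seat p4, `PerfectComplexDoor.lean`: the object class `perfectObjClass C Adm` (a bounded complex of vector bundles `E` on `X₀`,
  ADMISSIBLE — `Adm n X₀ I E` — with `κ|_I = ch(E)|_I`, `chPerfect`) and the transfer schema `PerfectComplexVariationalHodge C Adm`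
  (BF-5.1-model-shaped: admissible complex at one fibre + Chern character Hodge along the family ⟹ algebraic on an open
  neighbourhood); `Adm : AdmissibilityNotion` is a PARAMETER — p4's honesty clause, repeated: the PRINTED notion («`{1,…,n} ⊆ I`,
  `Ext^{<0}(E,E) = 0`, `E` simple, FULL Buchweitz–Flenner semiregularity map of `E` injective») has no carrier in the tree (no `σ`
  for a complex); its REAL sub-notion `rankAdmissible C` (p4, `PerfectComplexRankDoor.lean`: `Ext`-ranks in the derived category and
  `rank Ext² ≤` the polyvector contraction rank of `ch E`; contained in the printed notion ON PAPER by BF 2008 Prop. 6.4.4) is §5's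
  `Adm`; either way `PerfectComplexVariationalHodge C Adm` is an ASSUMPTION BY NAME (in print: Perry arXiv:2604.00511 Thm. 1.1, second
  bullet, `B₀ = 0`, preprint; refereed derivation of record `theory/TH2-ASSEMBLY-NOTE-2PAGE.md` §2–§3 from Perry 2022 Prop. 8.1,
  Lieblich 2006 Thm. 4.2.1, Pridham 2024 Cor. 2.25 / Rem. 2.27, Buchweitz–Flenner 2003 Rem. 4.7, Deligne 1968 Thm. 5.5) which the
  kernel does not link to those sources; for `Adm := bfAdmissible` it IS Buchweitz–Flenner's refereed Thm. 5.1 (`perfectComplexVariationalHodge_bf`).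
* seat p7, `AmplificationChainAssembly.lean` / `AmplificationChainSiegel.lean`: the door-agnostic chain (Weil-anchor currency:
  `weilFourfoldsSplit_of_reach_of_localVariationalHodgeFor_of_hyperbolicSeedOn`; `𝒜_g` per-component currency:
  `LocalVariationalHodgeFor.hc_on_siegelComponent_of_smul_add_of_baseChartAt`).
* the tree: Deligne's reach `weilFamilyReach_hyperbolic` (refereed named fact), the engine `weilClasses_algebraic_hyperbolic_of_localAnchor`,
  Schoen's descent `stub_descend`, the chart clauses of theory seats 2/3.

## Content

§1 `PerfectComplexVariationalHodge.localVariationalHodgeFor` — p4's schema IS `LocalVariationalHodgeFor (perfectObjClass C Adm)`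
(binder shuffle; `localVariationalHodgeFor_perfectObjClass_iff`). §2 Weil-anchor currency:
`splitHyperplane_of_reach_of_perfectComplexVariationalHodge_of_hyperbolicSeedOn` (any level `N`),
**`weilFourfoldsSplit_of_reach_of_perfectComplexVariationalHodge_of_hyperbolicSeedOn`** (g = 4), and the census-row shape
**`weilFourfoldsSplit_of_reach_of_perfectComplexVariationalHodge_of_complex`** (anchor `(P, ψ₀, e, a)` of dimension 4, split for
`h_K = symmetrisedClass d P ψ₀ e a`, `w ≠ 0` rational in the Weil plane, ONE bounded complex of vector bundles `E` on `P.X`,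
admissible, with `ch₂(E) = q·h_K² + w` and `ch_p(E) = c_p·h_Kᵖ` for `p ∈ I ∖ {2}` ⟹ `Stubs.WeilAlgebraicSplitHyperplane 2 d`), its
unfolded reading `weilClassesOf_fourfold_le_algebraicClasses_of_…_of_complex`, and `weilAlgebraicAll_of_…_lt` below a seed level.
§3 sanity: at `Adm := bfAdmissible` the g = 4 statement is UNCONDITIONAL in the transfer (BF Thm. 5.1 by name):
`weilFourfoldsSplit_of_reach_of_BFmodel_of_hyperbolicSeedOn_bfAdmissible`. §4 `𝒜_4` per-component currency:
`PerfectComplexVariationalHodge.hc_on_siegelFourfoldComponent_of_complex_of_baseChartAt`. §5 TIER 2 (`Adm := rankAdmissible C`, seat p4's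
REAL rank class; transfer `PerfectComplexRankTransfer C`): `weilFourfoldsSplit_of_reach_of_perfectComplexRankTransfer_of_{hyperbolicSeedOn,complex}`.
§6 the class hypothesis as seat p5's `IsMarkmanKappaShape` (in `h_K`, and in Markman's own polarization `h` with the rescaling).

## What remains BY VALUE for the STEP-0 object (the cell's census, not the kernel)

For `𝓔 = Φ(I_{p×X ∪ X×q}) ⊗ M_B` on `A₀ = X × X̂` (TH2-ASSEMBLY-NOTE-2PAGE §0): (I1) `Extⁱ(𝓔,𝓔) = (1,8,18,8,1)`, `Ext^{<0} = 0` and (I2-β)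
contraction rank `r = 18 ≥ dim Ext²` — together «`rankAdmissible C 4 A₀ I 𝓔`»; (I3) `ch₂(𝓔) = -h²/6 + w_re/6 + w_im/2` with Weil part `≠ 0`,
`ch_p(𝓔) ∈ ℚ·hᵖ` for `p ≠ 2` (seat p5's `IsMarkmanKappaShape`, §6); (I4) `(A₀, η_B, h_B)` split of signature `(2,2)`; and the existence of
`𝓔` as a bounded complex of vector bundles with these classes (seat p6's Mukai/Orlov files). Nothing about non-split components / sixfolds.
-/

noncomputable section

open CategoryTheory AlgebraicGeometry Set
open Literature.AlgebraicGeometry.Motives Literature.AlgebraicGeometry.HodgeTheory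
open Literature.AlgebraicGeometry.ModuliOfAbelianVarieties Literature.AlgebraicGeometry.Deligne1982
open Literature.AlgebraicGeometry.KTheory
open Literature.AlgebraicTopology.SingularHomology

namespace Summit.Ventures.HSemireg

local notation3 (prettyPrint := false) "Res[" f ", " s ", " k ", " A "]" =>
  complexBetti.map (Literature.AlgebraicGeometry.Motives.fiberι f s) k A

/-! ## §1 p4's transfer schema IS the local variational statement for the perfect object class -/

section Adapter

variable {C : ChernCharacterBetti} {Adm : AdmissibilityNotion}

/-- **Adapter**: the perfect-complex transfer schema `PerfectComplexVariationalHodge C Adm` (seat p4) gives the door-agnostic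
local variational statement `LocalVariationalHodgeFor (perfectObjClass C Adm)` — the two are the same `∀`-statement up to the
order of the binders `(I, κ)`. [cite: BuchweitzFlenner2003, §5 Thm. 5.1 (binder shape)] -/
theorem PerfectComplexVariationalHodge.localVariationalHodgeFor (h : PerfectComplexVariationalHodge C Adm) :
    LocalVariationalHodgeFor (perfectObjClass C Adm) :=
  fun _ _ π n hπ hS _ hU s₀ X₀ e I κ hκ hH ↦ h π n hπ hS hU s₀ X₀ e κ I hκ hH

/-- The adapter is an equivalence (same statement, binders reordered). [cite: BuchweitzFlenner2003, §5 Thm. 5.1 (binder shape)] -/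
theorem localVariationalHodgeFor_perfectObjClass_iff :
    LocalVariationalHodgeFor (perfectObjClass C Adm) ↔ PerfectComplexVariationalHodge C Adm :=
  ⟨fun h _ _ π n hπ hS _ hU s₀ X₀ e κ I hκ hH ↦ h π n hπ hS hU s₀ X₀ e I κ hκ hH, fun h ↦ h.localVariationalHodgeFor⟩

end Adapter

/-! ## §2 Weil-anchor currency: every abelian fourfold of the split `ℚ(√-d)`-Weil component -/

section Weil

open Summit.HodgeConjecture.HodgeConjecture
open Summit.HodgeConjecture.HodgeConjecture.WeilTypeLadder
open Summit.HodgeConjecture.HodgeConjecture.Cruxes.HodgeAbelianVarieties.EStepSecantInduction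
open Summit.Ventures.HSemireg.GeneralStructure

variable {C : ChernCharacterBetti} {Adm : AdmissibilityNotion}

/-- **Route (C) at ONE level `(N, d)`**: Deligne's reach ∧ the perfect-complex transfer schema for `Adm` ∧ ONE hyperbolic seed of
the class `perfectObjClass C Adm` (an admissible bounded complex of vector bundles on a split `ℚ(√-d)`-Weil `2N`-fold with
`ch_N = q·h_Kᴺ + w`, `ch_p = c_p·h_Kᵖ` off `N`) ⟹ the Weil classes of every SPLIT `ℚ(√-d)`-Weil `2N`-fold are algebraic. A schema in
`Adm` (module docstring). [claim: Perry2026Semiregularity, status: under-review] [cite: Perry2022, Prop. 8.1]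
[cite: Deligne1982HodgeCycles, proof of Thm. 4.8] -/
theorem splitHyperplane_of_reach_of_perfectComplexVariationalHodge_of_hyperbolicSeedOn (hF : weilFamilyReach_hyperbolic)
    {N d : ℕ} (hN : 1 ≤ N) (hd : 0 < d) (hT : PerfectComplexVariationalHodge C Adm)
    (hS : HasHyperbolicSeedOn (perfectObjClass C Adm) N d) : Stubs.WeilAlgebraicSplitHyperplane N d :=
  splitHyperplane_of_reach_of_localVariationalHodgeFor_of_hyperbolicSeedOn hF hN hd hT.localVariationalHodgeFor hS

/-- **Route (C) below a seed level** (Schoen's descent): the same inputs at level `N` give `WeilAlgebraicAll n d` for every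
`2 ≤ n < N`. [cite: Schoen1998HodgeWeilAddendum, §10] [cite: Deligne1982HodgeCycles, proof of Thm. 4.8] -/
theorem weilAlgebraicAll_of_reach_of_perfectComplexVariationalHodge_of_hyperbolicSeedOn_lt (hF : weilFamilyReach_hyperbolic)
    {N d : ℕ} (hT : PerfectComplexVariationalHodge C Adm) (hS : HasHyperbolicSeedOn (perfectObjClass C Adm) N d) {n : ℕ}
    (hn : 2 ≤ n) (hnN : n < N) (hd : 0 < d) : WeilAlgebraicAll n d :=
  weilAlgebraicAll_of_localVariationalHodgeFor_of_hyperbolicSeedOn_lt hF hT.localVariationalHodgeFor hS hn hnN hd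

/-- **g = 4, route (C) — the cell's IN-TREE CONDITIONAL THEOREM.** Hypotheses BY NAME: `weilFamilyReach_hyperbolic` (Deligne,
refereed named fact); `PerfectComplexVariationalHodge C Adm` (seat p4's transfer schema — for the intended admissibility notion
an ASSUMPTION of printed strength: Perry 2026 Thm. 1.1 second bullet with `B₀ = 0` / the refereed chain Perry 2022 Prop. 8.1 +
Lieblich 2006 + Pridham 2024 Cor. 2.25, Rem. 2.27 + BF 2003 + Deligne 1968); `0 < d`; and ONE hyperbolic seed of class
`perfectObjClass C Adm` on a split `ℚ(√-d)`-Weil abelian fourfold (the STEP-0 object at the CM point with its certificate, by value).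
Conclusion: `Stubs.WeilAlgebraicSplitHyperplane 2 d` — the Weil classes of EVERY abelian fourfold of the split `ℚ(√-d)`-Weil
component are algebraic (Markman's theorem for that component, re-derived; no new case; nothing about non-split components).
[claim: Perry2026Semiregularity, status: under-review] [cite: Perry2022, Prop. 8.1] [cite: Pridham2024Semiregularity, Cor. 2.25, Rem. 2.27]
[cite: Deligne1982HodgeCycles, proof of Thm. 4.8] [cite: Markman2023GeneralizedKummers, Theorem 1.5 (= Theorem 13.4), p. 236 (the split fourfold case in print; arXiv:1805.11574 pre-publication numbering: Theorem 1.3)]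
[cite: Markman2025SecantWeil, Thm. 1.5.1 (statement re-derived; preprint)] -/
theorem weilFourfoldsSplit_of_reach_of_perfectComplexVariationalHodge_of_hyperbolicSeedOn (hF : weilFamilyReach_hyperbolic)
    (hT : PerfectComplexVariationalHodge C Adm) {d : ℕ} (hd : 0 < d) (hS : HasHyperbolicSeedOn (perfectObjClass C Adm) 2 d) :
    Stubs.WeilAlgebraicSplitHyperplane 2 d :=
  weilFourfoldsSplit_of_reach_of_localVariationalHodgeFor_of_hyperbolicSeedOn hF hT.localVariationalHodgeFor hd hS

/-- **g = 4, route (C), the census row UNBUNDLED** (every binder is a real tree carrier except the admissibility clause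
`hAdm : Adm (2·2) P.X I E`, which is whatever notion `Adm` the transfer schema is granted for): a complex abelian fourfold `P` with
`ψ₀ ≫ ψ₀ = -d`, a projective embedding `e` and rational `a ≠ 0` such that `(P, ψ₀)` is of SPLIT (hyperbolic) Weil type for
`h_K = d·e^*a + ψ₀^*e^*a` (`symmetrisedClass`), a non-zero rational class `w` of the Weil plane `weilClassesOf P ψ₀ 2 d`, a finite set
of Chern degrees `I ∋ 2`, ONE bounded complex of vector bundles `E` on `P.X` which is admissible, and rationals `q`, `c_p` with
`ch₂(E) = q·h_K² + w` and `ch_p(E) = c_p·h_Kᵖ` for `p ∈ I`, `p ≠ 2` (`chPerfect`, seat p4; Markman's class statement in the shape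
seat p5 renders: `κ(𝓔) ∈ ℚ[h] ⊕ W_K` with non-zero Weil part) ⟹ `Stubs.WeilAlgebraicSplitHyperplane 2 d`. For the STEP-0 object:
`P = X × X̂`, `X = E_i × E_i`, `ψ₀ = η_B(√-d)`, `E = Φ(I_{p×X ∪ X×q}) ⊗ M_B`, `I = {1,2,3,4}`, `d ∈ {3, 7, 11, 15}` (by value).
[claim: Perry2026Semiregularity, status: under-review] [cite: Perry2022, Prop. 8.1] [cite: Deligne1982HodgeCycles, proof of Thm. 4.8]
[cite: Markman2023GeneralizedKummers, Theorem 1.5 (= Theorem 13.4), p. 236 (arXiv:1805.11574 pre-publication numbering: Theorem 1.3)] [cite: Markman2025SecantWeil, §1.5 and Thm. 1.5.1 (preprint)]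
[cite: vanGeemen1994HodgeAV, 5.2–5.4] -/
theorem weilFourfoldsSplit_of_reach_of_perfectComplexVariationalHodge_of_complex (hF : weilFamilyReach_hyperbolic)
    (hT : PerfectComplexVariationalHodge C Adm) {d : ℕ} (hd : 0 < d)
    (P : AbelianVariety ℂ) (ψ₀ : P ⟶ P) (e : ProjectiveEmbedding P.X) (a : complexBetti (projectiveSpace e.n ℂ) 2)
    (hP : P.dim = 2 * 2) (hψ : ψ₀ ≫ ψ₀ = -(d • 𝟙 P)) (ha : IsRationalClass a) (ha0 : a ≠ 0)
    (hhyp : IsHyperbolicWeilType P ψ₀ 2 (symmetrisedClass d P ψ₀ e a))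
    (w : complexBetti P.X (2 * 2)) (hwW : w ∈ weilClassesOf P ψ₀ 2 d) (hwr : IsRationalClass w) (hw0 : w ≠ 0)
    (I : Finset ℕ) (h2 : 2 ∈ I) (E : CochainComplex P.X.left.Modules ℤ) (hE : IsBoundedVBComplex E)
    (hAdm : Adm (2 * 2) P.X I E) (q : ℚ) (c : ℕ → ℚ)
    (hch2 : chPerfect C P.X E hE.isFiniteLocallyFree 2 = ((q : ℚ) : ℂ) • cupPowTwo (symmetrisedClass d P ψ₀ e a) 2 + w)
    (hchp : ∀ p ∈ I, p ≠ 2 →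
      chPerfect C P.X E hE.isFiniteLocallyFree p = ((c p : ℚ) : ℂ) • cupPowTwo (symmetrisedClass d P ψ₀ e a) p) :
    Stubs.WeilAlgebraicSplitHyperplane 2 d :=
  weilFourfoldsSplit_of_reach_of_perfectComplexVariationalHodge_of_hyperbolicSeedOn hF hT hd
    ⟨P, ψ₀, e, a, w, hP, hψ, ha, ha0, hhyp, hwW, hwr, hw0, I, fun p ↦ chPerfect C P.X E hE.isFiniteLocallyFree p, q, c, h2,
      ⟨E, hE, hAdm, fun _ _ ↦ rfl⟩, hch2, hchp⟩

/-- **g = 4, route (C), unfolded reading** of the census-row form: under the same hypotheses, for every complex abelian FOURFOLD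
`A` with `φ ≫ φ = -(d • 𝟙 A)` which is of split Weil type for some `h'_K = d·e_A^*a_A + φ^*e_A^*a_A`, the whole Weil plane
`weilClassesOf A φ 2 d ⊆ H⁴(A(ℂ); ℂ)` consists of algebraic classes. [claim: Perry2026Semiregularity, status: under-review]
[cite: Perry2022, Prop. 8.1] [cite: Deligne1982HodgeCycles, proof of Thm. 4.8] [cite: Markman2023GeneralizedKummers, Theorem 1.5 (= Theorem 13.4), p. 236 (arXiv:1805.11574 pre-publication numbering: Theorem 1.3)]
[cite: Markman2025SecantWeil, Thm. 1.5.1 (preprint)] -/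
theorem weilClassesOf_fourfold_le_algebraicClasses_of_reach_of_perfectComplexVariationalHodge_of_complex
    (hF : weilFamilyReach_hyperbolic) (hT : PerfectComplexVariationalHodge C Adm) {d : ℕ} (hd : 0 < d)
    (P : AbelianVariety ℂ) (ψ₀ : P ⟶ P) (e : ProjectiveEmbedding P.X) (a : complexBetti (projectiveSpace e.n ℂ) 2)
    (hP : P.dim = 2 * 2) (hψ : ψ₀ ≫ ψ₀ = -(d • 𝟙 P)) (ha : IsRationalClass a) (ha0 : a ≠ 0)
    (hhyp : IsHyperbolicWeilType P ψ₀ 2 (symmetrisedClass d P ψ₀ e a))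
    (w : complexBetti P.X (2 * 2)) (hwW : w ∈ weilClassesOf P ψ₀ 2 d) (hwr : IsRationalClass w) (hw0 : w ≠ 0)
    (I : Finset ℕ) (h2 : 2 ∈ I) (E : CochainComplex P.X.left.Modules ℤ) (hE : IsBoundedVBComplex E)
    (hAdm : Adm (2 * 2) P.X I E) (q : ℚ) (c : ℕ → ℚ)
    (hch2 : chPerfect C P.X E hE.isFiniteLocallyFree 2 = ((q : ℚ) : ℂ) • cupPowTwo (symmetrisedClass d P ψ₀ e a) 2 + w)
    (hchp : ∀ p ∈ I, p ≠ 2 →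
      chPerfect C P.X E hE.isFiniteLocallyFree p = ((c p : ℚ) : ℂ) • cupPowTwo (symmetrisedClass d P ψ₀ e a) p)
    (A : AbelianVariety ℂ) (φ : A ⟶ A) (hA : A.dim = 2 * 2) (hφ : φ ≫ φ = -(d • 𝟙 A)) (eA : ProjectiveEmbedding A.X)
    (aA : complexBetti (projectiveSpace eA.n ℂ) 2) (haA : IsRationalClass aA) (haA0 : aA ≠ 0)
    (hhypA : IsHyperbolicWeilType A φ 2 (symmetrisedClass d A φ eA aA)) :
    weilClassesOf A φ 2 d ≤ algebraicClasses A.X 2 :=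
  weilClassesOf_fourfold_le_algebraicClasses_of_reach_of_localVariationalHodgeFor_of_hyperbolicSeedOn hF
    hT.localVariationalHodgeFor hd
    ⟨P, ψ₀, e, a, w, hP, hψ, ha, ha0, hhyp, hwW, hwr, hw0, I, fun p ↦ chPerfect C P.X E hE.isFiniteLocallyFree p, q, c, h2,
      ⟨E, hE, hAdm, fun _ _ ↦ rfl⟩, hch2, hchp⟩ A φ hA hφ eA aA haA haA0 hhypA

/-! ## §3 (sanity) At `Adm := bfAdmissible` the transfer is Buchweitz–Flenner's refereed Thm. 5.1: g = 4 with NO schema -/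

/-- **Sanity instance**: for the Buchweitz–Flenner admissibility notion `bfAdmissible` (a complex concentrated in degree `0` whose
term is a finite locally free `I`-semiregular sheaf — seat p4) the transfer schema is PROVED from the refereed tree fact
`BuchweitzFlenner2003_variationalHodge_ISemiregular_model` (`perfectComplexVariationalHodge_bf`), so g = 4 reads: reach ∧ BF Thm. 5.1 ∧
ONE hyperbolic seed of class `perfectObjClass C bfAdmissible` on a split `ℚ(√-d)`-Weil fourfold ⟹ every split `√-d`-Weil fourfold — the
vector-bundle door of `SheafSeedOnAnchor.lean` again, reached through the perfect-complex door's own sanity instance (no such bundle is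
claimed by the cell). [cite: BuchweitzFlenner2003, §5 Thm. 5.1] [cite: Deligne1982HodgeCycles, proof of Thm. 4.8] -/
theorem weilFourfoldsSplit_of_reach_of_BFmodel_of_hyperbolicSeedOn_bfAdmissible (hF : weilFamilyReach_hyperbolic)
    (hBF : BuchweitzFlenner2003_variationalHodge_ISemiregular_model) (C : ChernCharacterBetti) {d : ℕ} (hd : 0 < d)
    (hS : HasHyperbolicSeedOn (perfectObjClass C bfAdmissible) 2 d) : Stubs.WeilAlgebraicSplitHyperplane 2 d :=
  weilFourfoldsSplit_of_reach_of_perfectComplexVariationalHodge_of_hyperbolicSeedOn hF (perfectComplexVariationalHodge_bf hBF C)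
    hd hS

end Weil

/-! ## §4 `𝒜_4` per-component currency: route (C) through the door-agnostic Siegel chain -/

section Siegel

variable {C : ChernCharacterBetti} {Adm : AdmissibilityNotion} {δ : Fin 4 → ℕ} {N : ℕ}

/-- **g = 4, route (C), per Hodge-locus component of `𝒜_{4,δ,N}`** (the coordinator's sentence «a semiregular representative at ONE
point of a Hodge-locus component ⟹ HC on THAT component», perfect-complex door): on the universal family of `𝒜_{4,δ,N}`, a connected
component `C'` of the locus of rational `(2,2)`-classes, granted the base chart at `C'` (cell assumption, theory seats 2/3) and
`deligne_globalInvariantCycles` (cited), the transfer schema `PerfectComplexVariationalHodge C Adm`, fibrewise `(p',p')` global classes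
`Λ_{p'}` (`p' ∈ I`; user: powers of the relative polarisation) with `Λ_2` fibrewise rational and algebraic, a point `(t₀, α₀) ∈ C'`,
and — on ONE model `e : X₀ ≅ 𝒴_{t₀}` — ONE admissible bounded complex of vector bundles `E` (`Adm 4 X₀ I E`) with
`ch₂(E) = e^*(a·α₀ + b·Λ_2|_{t₀})`, `a ≠ 0`, and `ch_{p'}(E) = e^*(c_{p'}·Λ_{p'}|_{t₀})` for `p' ∈ I ∖ {2}`: `α` is algebraic on `𝒴_t`
for EVERY `(t, α) ∈ C'`. A schema in `Adm` (module docstring). [claim: Perry2026Semiregularity, status: under-review]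
[cite: Perry2022, Prop. 8.1] [cite: DeligneHodgeII1971, Théorème 4.1.1] [cite: CattaniDeligneKaplan1995JAMS, Thm. 1.1 and Cor. 1.2] -/
theorem PerfectComplexVariationalHodge.hc_on_siegelFourfoldComponent_of_complex_of_baseChartAt
    (hT : PerfectComplexVariationalHodge C Adm) {D : SiegelModuliDatum 4 δ N} {C' : HodgeLocusComponent D.f 4 2}
    (hS : SiegelHodgeLocusBaseChartAt D 2 C') (hGIC : deligne_globalInvariantCycles) (I : Finset ℕ) (h2 : 2 ∈ I)
    (Λ : (p' : ℕ) → complexBetti D.𝒳 (2 * p'))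
    (hΛ : ∀ p' ∈ I, ∀ s : ComplexPoints D.S, IsOfHodgeType 4 (fiberOver D.f s) (2 * p') p' p' (Res[D.f, s, 2 * p', Λ p']))
    (hΛ2 : ∀ s : ComplexPoints D.S, IsRationalClass (Res[D.f, s, 2 * 2, Λ 2]) ∧
      Res[D.f, s, 2 * 2, Λ 2] ∈ algebraicClasses (fiberOver D.f s) 2)
    {x₀ : FiberClass D.f (2 * 2)} (hx₀ : x₀ ∈ C'.carrier) (a b : ℚ) (ha : a ≠ 0) (c : ℕ → ℚ)
    (X₀ : SchemeOver ℂ) (e : X₀ ≅ fiberOver D.f x₀.pt)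
    (E : CochainComplex X₀.left.Modules ℤ) (hE : IsBoundedVBComplex E) (hAdm : Adm 4 X₀ I E)
    (hch2 : chPerfect C X₀ E hE.isFiniteLocallyFree 2 =
      complexBetti.map e.hom (2 * 2) ((a : ℂ) • x₀.cls + (b : ℂ) • Res[D.f, x₀.pt, 2 * 2, Λ 2]))
    (hchp' : ∀ p' ∈ I, p' ≠ 2 → chPerfect C X₀ E hE.isFiniteLocallyFree p' =
      complexBetti.map e.hom (2 * p') (((c p' : ℚ) : ℂ) • Res[D.f, x₀.pt, 2 * p', Λ p'])) :
    ∀ x ∈ C'.carrier, x.cls ∈ algebraicClasses (fiberOver D.f x.pt) 2 :=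
  hc_on_siegelFourfoldComponent_of_localVariationalHodgeFor_of_baseChartAt hT.localVariationalHodgeFor hS hGIC I h2 Λ hΛ hΛ2 hx₀
    a b ha c X₀ e (fun p' ↦ chPerfect C X₀ E hE.isFiniteLocallyFree p') ⟨E, hE, hAdm, fun _ _ ↦ rfl⟩ hch2 hchp'

end Siegel

/-! ## §5 TIER 2 — the admissibility notion on REAL carriers: `Adm := rankAdmissible C` (seat p4, `PerfectComplexRankDoor.lean`)

WORDING RULE F-1 (red-5), once for §5–§6: every sentence names its admissibility notion (`rankAdmissible C`: REAL carriers — `Ext`-ranks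
in Mathlib's derived category of `𝒪_{X₀}`-modules, polyvector contraction rank on `Λ H¹` — of PRINTED STRENGTH only ON PAPER via BF 2008
Prop. 6.4.4; `bfAdmissible`: typed, = BF Thm. 5.1; a bare `Adm`: a parameter); THE KERNEL DOES NOT LINK ANY `Adm` TO PRIDHAM / PERRY
(`PerfectComplexRankTransfer C` is an assumption BY NAME); the seed is BY VALUE from the census ((I1) `Ext^• = (1,8,18,8,1)`; (I2-β) `r = 18`; (I3)). -/

section TierTwo

open Summit.HodgeConjecture.HodgeConjecture
open Summit.HodgeConjecture.HodgeConjecture.WeilTypeLadder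
open Summit.HodgeConjecture.HodgeConjecture.Cruxes.HodgeAbelianVarieties.EStepSecantInduction
open Summit.Ventures.HSemireg.GeneralStructure

variable {C : ChernCharacterBetti}

/-- **The rank transfer IS the local variational statement for the rank object class** (`PerfectComplexRankTransfer C` unfolds to
`PerfectComplexVariationalHodge C (rankAdmissible C)`, seat p4's `perfectComplexRankTransfer_iff`; then §1's binder shuffle).
[cite: BuchweitzFlenner2008HH, Prop. 6.4.4] [cite: BuchweitzFlenner2003, §5 Thm. 5.1 (binder shape)] -/
theorem PerfectComplexRankTransfer.localVariationalHodgeFor (h : PerfectComplexRankTransfer C) :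
    LocalVariationalHodgeFor (rankObjClass C) :=
  PerfectComplexVariationalHodge.localVariationalHodgeFor ((perfectComplexRankTransfer_iff C).1 h)

/-- **g = 4, route (C), TIER 2 — every hypothesis on real carriers.** Hypotheses BY NAME: `weilFamilyReach_hyperbolic` (refereed
fact); `PerfectComplexRankTransfer C` (seat p4: the perfect-complex transfer for the REAL rank class «`{1..n} ⊆ I`, `Ext^{<0}(E,E) = 0`,
`Hom(E,E) = ℂ`, `rank Ext²(E,E) ≤ r(A, ch E)`» — an ASSUMPTION of the venture; of printed strength on paper by BF 2008 Prop. 6.4.4 +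
Perry 2022 Prop. 8.1 / Pridham 2024 / Lieblich 2006; the kernel does not link it to those sources); `0 < d`; ONE hyperbolic seed of
class `rankObjClass C` on a split `ℚ(√-d)`-Weil fourfold (by value from the census). Conclusion: `Stubs.WeilAlgebraicSplitHyperplane 2 d`.
[claim: Perry2026Semiregularity, status: under-review] [cite: BuchweitzFlenner2008HH, Prop. 6.4.4] [cite: Perry2022, Prop. 8.1]
[cite: Deligne1982HodgeCycles, proof of Thm. 4.8] [cite: Markman2023GeneralizedKummers, Theorem 1.5 (= Theorem 13.4), p. 236 (the case in print; arXiv:1805.11574 pre-publication numbering: Theorem 1.3)] -/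
theorem weilFourfoldsSplit_of_reach_of_perfectComplexRankTransfer_of_hyperbolicSeedOn (hF : weilFamilyReach_hyperbolic)
    (hT : PerfectComplexRankTransfer C) {d : ℕ} (hd : 0 < d) (hS : HasHyperbolicSeedOn (rankObjClass C) 2 d) :
    Stubs.WeilAlgebraicSplitHyperplane 2 d :=
  weilFourfoldsSplit_of_reach_of_localVariationalHodgeFor_of_hyperbolicSeedOn hF hT.localVariationalHodgeFor hd hS

/-- **g = 4, route (C), TIER 2, the census row UNBUNDLED — every binder a real tree carrier.** A complex abelian fourfold `P`
(`P.dim = 4`) with `ψ₀ ≫ ψ₀ = -d`, a projective embedding `e` and rational `a ≠ 0` such that `(P, ψ₀)` is of SPLIT Weil type for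
`h_K = symmetrisedClass d P ψ₀ e a`; a non-zero rational class `w` of the Weil plane; a finite set of Chern degrees `I ⊇ {1,2,3,4}`; ONE
bounded complex of vector bundles `E` on `P.X` with `Ext^{k}_{D(P.X)}(E,E) = 0` for `k < 0` and `Hom(E,E) = ℂ` (`extRank`, Mathlib's
derived category) and `rank Ext²(E,E) ≤ r(P, ch E)` (`contractionRank`, the polyvector contraction rank of the total Chern character
in `Λ H¹(P)`); and rationals `q`, `c_p` with `ch₂(E) = q·h_K² + w`, `ch_p(E) = c_p·h_Kᵖ` for `p ∈ I ∖ {2}` ⟹ under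
`weilFamilyReach_hyperbolic` and the ASSUMPTION `PerfectComplexRankTransfer C`, the Weil classes of EVERY split `√-d`-Weil abelian
fourfold are algebraic. For the STEP-0 object (by value): `P = X × X̂` (`X = E_i × E_i`), `E = Φ(I_{p×X ∪ X×q}) ⊗ M_B`,
`Ext^• = (1,8,18,8,1)`, `r = 18`, `d ∈ {3,7,11,15}`. The kernel does not link `rankAdmissible` to Pridham / Perry (F-1).
[claim: Perry2026Semiregularity, status: under-review] [cite: BuchweitzFlenner2008HH, Prop. 6.4.4] [cite: Perry2022, Prop. 8.1]
[cite: Deligne1982HodgeCycles, proof of Thm. 4.8] [cite: Markman2025SecantWeil, §1.5 and Thm. 1.5.1 (preprint)]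
[cite: Markman2023GeneralizedKummers, Theorem 1.5 (= Theorem 13.4), p. 236 (arXiv:1805.11574 pre-publication numbering: Theorem 1.3)] -/
theorem weilFourfoldsSplit_of_reach_of_perfectComplexRankTransfer_of_complex (hF : weilFamilyReach_hyperbolic)
    (hT : PerfectComplexRankTransfer C) {d : ℕ} (hd : 0 < d)
    (P : AbelianVariety ℂ) (ψ₀ : P ⟶ P) (e : ProjectiveEmbedding P.X) (a : complexBetti (projectiveSpace e.n ℂ) 2)
    (hP : P.dim = 2 * 2) (hψ : ψ₀ ≫ ψ₀ = -(d • 𝟙 P)) (ha : IsRationalClass a) (ha0 : a ≠ 0)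
    (hhyp : IsHyperbolicWeilType P ψ₀ 2 (symmetrisedClass d P ψ₀ e a))
    (w : complexBetti P.X (2 * 2)) (hwW : w ∈ weilClassesOf P ψ₀ 2 d) (hwr : IsRationalClass w) (hw0 : w ≠ 0)
    (I : Finset ℕ) (hI : ∀ p : ℕ, 1 ≤ p → p ≤ 2 * 2 → p ∈ I) (E : CochainComplex P.X.left.Modules ℤ) (hE : IsBoundedVBComplex E)
    (hneg : ∀ k : ℤ, k < 0 → extRank P.X E k = 0) (h0 : extRank P.X E 0 = 1)
    (h2 : extRank P.X E 2 ≤ Cardinal.lift.{1} (contractionRank P fun p ↦ chPerfect C P.X E hE.isFiniteLocallyFree p))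
    (q : ℚ) (c : ℕ → ℚ)
    (hch2 : chPerfect C P.X E hE.isFiniteLocallyFree 2 = ((q : ℚ) : ℂ) • cupPowTwo (symmetrisedClass d P ψ₀ e a) 2 + w)
    (hchp : ∀ p ∈ I, p ≠ 2 →
      chPerfect C P.X E hE.isFiniteLocallyFree p = ((c p : ℚ) : ℂ) • cupPowTwo (symmetrisedClass d P ψ₀ e a) p) :
    Stubs.WeilAlgebraicSplitHyperplane 2 d := by
  have hfun : (fun p ↦ complexBetti.map (Iso.refl P.X).hom (2 * p) (chPerfect C P.X E hE.isFiniteLocallyFree p)) =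
      fun p ↦ chPerfect C P.X E hE.isFiniteLocallyFree p := by
    funext p
    rw [Iso.refl_hom, complexBetti.map_id]
    rfl
  have h2' : extRank P.X E 2 ≤ Cardinal.lift.{1} (contractionRank P fun p ↦
      complexBetti.map (Iso.refl P.X).hom (2 * p) (chPerfect C P.X E hE.isFiniteLocallyFree p)) := by
    rw [hfun]
    exact h2
  have hAdm : rankAdmissible C (2 * 2) P.X I E := ⟨hI, hneg, h0, P, Iso.refl P.X, hE, hP, h2'⟩
  exact weilFourfoldsSplit_of_reach_of_perfectComplexVariationalHodge_of_complex hF ((perfectComplexRankTransfer_iff C).1 hT) hd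
    P ψ₀ e a hP hψ ha ha0 hhyp w hwW hwr hw0 I (hI 2 (by norm_num) (by norm_num)) E hE hAdm q c hch2 hchp

end TierTwo

/-! ## §6 The class hypothesis in Markman's printed shape (seat p5, `MarkmanKappaShape.lean`) -/

section MarkmanShape

open Summit.HodgeConjecture.HodgeConjecture
open Summit.HodgeConjecture.HodgeConjecture.WeilTypeLadder
open Summit.HodgeConjecture.HodgeConjecture.Cruxes.HodgeAbelianVarieties.EStepSecantInduction
open Summit.Ventures.HSemireg.GeneralStructure

variable {C : ChernCharacterBetti} {Adm : AdmissibilityNotion}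

/-- **g = 4, route (C), with the Chern-character hypothesis as seat p5's `IsMarkmanKappaShape`** (Markman 2025 Cor. 1.3.2 /
Lemma 2.2.7 / Cor. 4.0.4 / Thm. 1.4.1(4) read for `e = 2`: `w` a non-zero rational class of the Weil plane, `ch₂(E) = q·h_K² + w`,
`ch_p(E) = c_p·h_Kᵖ` off `p = 2`), for the currency class `h_K = symmetrisedClass d P ψ₀ e a`: reach ∧ `PerfectComplexVariationalHodge C Adm`
(schema in `Adm`; the kernel does not link `Adm` to Pridham / Perry) ∧ ONE admissible bounded complex of vector bundles `E` on the split
anchor with `IsMarkmanKappaShape 2 d P ψ₀ h_K I (ch E) w` ⟹ `Stubs.WeilAlgebraicSplitHyperplane 2 d`.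
[claim: Perry2026Semiregularity, status: under-review] [cite: Markman2025SecantWeil, Cor. 1.3.2, Lemma 2.2.7 and Thm. 1.4.1 (4) (preprint)]
[cite: Perry2022, Prop. 8.1] [cite: Deligne1982HodgeCycles, proof of Thm. 4.8] [cite: Markman2023GeneralizedKummers, Theorem 1.5 (= Theorem 13.4), p. 236 (arXiv:1805.11574 pre-publication numbering: Theorem 1.3)] -/
theorem weilFourfoldsSplit_of_reach_of_perfectComplexVariationalHodge_of_isMarkmanKappaShape (hF : weilFamilyReach_hyperbolic)
    (hT : PerfectComplexVariationalHodge C Adm) {d : ℕ} (hd : 0 < d)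
    (P : AbelianVariety ℂ) (ψ₀ : P ⟶ P) (e : ProjectiveEmbedding P.X) (a : complexBetti (projectiveSpace e.n ℂ) 2)
    (hP : P.dim = 2 * 2) (hψ : ψ₀ ≫ ψ₀ = -(d • 𝟙 P)) (ha : IsRationalClass a) (ha0 : a ≠ 0)
    (hhyp : IsHyperbolicWeilType P ψ₀ 2 (symmetrisedClass d P ψ₀ e a)) {w : complexBetti P.X (2 * 2)} {I : Finset ℕ}
    (h2 : 2 ∈ I) (E : CochainComplex P.X.left.Modules ℤ) (hE : IsBoundedVBComplex E) (hAdm : Adm (2 * 2) P.X I E)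
    (hκ : IsMarkmanKappaShape 2 d P ψ₀ (symmetrisedClass d P ψ₀ e a) I (fun p ↦ chPerfect C P.X E hE.isFiniteLocallyFree p) w) :
    Stubs.WeilAlgebraicSplitHyperplane 2 d := by
  obtain ⟨hwW, hwr, hw0, q, c, hch2, hchp⟩ := hκ
  exact weilFourfoldsSplit_of_reach_of_perfectComplexVariationalHodge_of_complex hF hT hd P ψ₀ e a hP hψ ha ha0 hhyp w hwW hwr hw0
    I h2 E hE hAdm q c hch2 hchp

/-- **g = 4, route (C), the class hypothesis stated in Markman's OWN polarization `h`** (the census certificate (I3) is computed in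
`h_B`): if `ψ₀^*h = d·h` (Markman §1.3: `η(k)` acts on `h` by `Nm(k)`), the hyperplane class of the embedding is `e^*a = m·h` with
`m ∈ ℚ^×`, `(P, ψ₀)` is of split Weil type for `h`, and `IsMarkmanKappaShape 2 d P ψ₀ h I (ch E) w` — then the currency's `h_K = 2dm·h`
(seat p5's `symmetrisedClass_eq_smul_of_map_eq`, `IsMarkmanKappaShape.symmetrised`; hyperbolicity moves along the rescaling by the tree's
`isHyperbolicWeilType_smul_iff`) and the previous theorem applies: `Stubs.WeilAlgebraicSplitHyperplane 2 d`. Schema in `Adm` (F-1).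
[claim: Perry2026Semiregularity, status: under-review] [cite: Markman2025SecantWeil, §1.3, Cor. 1.3.2 and Thm. 1.4.1 (4) (preprint)]
[cite: vanGeemen1994HodgeAV, Lemma 5.2] [cite: Deligne1982HodgeCycles, proof of Thm. 4.8] [cite: Markman2023GeneralizedKummers, Theorem 1.5 (= Theorem 13.4), p. 236 (arXiv:1805.11574 pre-publication numbering: Theorem 1.3)] -/
theorem weilFourfoldsSplit_of_reach_of_perfectComplexVariationalHodge_of_isMarkmanKappaShape_polarization
    (hF : weilFamilyReach_hyperbolic) (hT : PerfectComplexVariationalHodge C Adm) {d : ℕ} (hd : 0 < d)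
    (P : AbelianVariety ℂ) (ψ₀ : P ⟶ P) (hP : P.dim = 2 * 2) (hψ : ψ₀ ≫ ψ₀ = -(d • 𝟙 P)) (h : complexBetti P.X 2)
    (hψh : complexBetti.map ψ₀.hom.hom.hom 2 h = (d : ℂ) • h) (hhyp : IsHyperbolicWeilType P ψ₀ 2 h)
    (e : ProjectiveEmbedding P.X) (a : complexBetti (projectiveSpace e.n ℂ) 2) (ha : IsRationalClass a) (ha0 : a ≠ 0)
    {m : ℚ} (hm : m ≠ 0) (hι : complexBetti.map e.ι 2 a = ((m : ℚ) : ℂ) • h) {w : complexBetti P.X (2 * 2)} {I : Finset ℕ}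
    (h2 : 2 ∈ I) (E : CochainComplex P.X.left.Modules ℤ) (hE : IsBoundedVBComplex E) (hAdm : Adm (2 * 2) P.X I E)
    (hκ : IsMarkmanKappaShape 2 d P ψ₀ h I (fun p ↦ chPerfect C P.X E hE.isFiniteLocallyFree p) w) :
    Stubs.WeilAlgebraicSplitHyperplane 2 d := by
  have hκ' := hκ.symmetrised hd e a hm hι hψh
  have hc : (((2 * d * m : ℚ)) : ℂ) ≠ 0 := by
    have hd' : (d : ℚ) ≠ 0 := by exact_mod_cast hd.ne'
    exact_mod_cast mul_ne_zero (mul_ne_zero two_ne_zero hd') hm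
  have hhyp' : IsHyperbolicWeilType P ψ₀ 2 (symmetrisedClass d P ψ₀ e a) := by
    rw [symmetrisedClass_eq_smul_of_map_eq e a hι hψh]
    exact (isHyperbolicWeilType_smul_iff hc).2 hhyp
  exact weilFourfoldsSplit_of_reach_of_perfectComplexVariationalHodge_of_isMarkmanKappaShape hF hT hd P ψ₀ e a hP hψ ha ha0 hhyp'
    h2 E hE hAdm hκ'

/-- **TIER 2 × Markman shape**: the same with `Adm := rankAdmissible C` and the transfer `PerfectComplexRankTransfer C` (seat p4) —
the form whose every binder is a real carrier and whose inputs are literally the census certificate: (I1)+(I2-β) = `hAdm`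
(`Ext`-ranks and the contraction-rank inequality), (I3) = `hκ`, (I4) = `hhyp`. F-1: the kernel does not link `rankAdmissible` to
Pridham / Perry; `PerfectComplexRankTransfer C` is an assumption by name. [claim: Perry2026Semiregularity, status: under-review]
[cite: BuchweitzFlenner2008HH, Prop. 6.4.4] [cite: Markman2025SecantWeil, Cor. 1.3.2 and Thm. 1.4.1 (4) (preprint)]
[cite: Deligne1982HodgeCycles, proof of Thm. 4.8] [cite: Markman2023GeneralizedKummers, Theorem 1.5 (= Theorem 13.4), p. 236 (arXiv:1805.11574 pre-publication numbering: Theorem 1.3)] -/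
theorem weilFourfoldsSplit_of_reach_of_perfectComplexRankTransfer_of_isMarkmanKappaShape (hF : weilFamilyReach_hyperbolic)
    (hT : PerfectComplexRankTransfer C) {d : ℕ} (hd : 0 < d)
    (P : AbelianVariety ℂ) (ψ₀ : P ⟶ P) (e : ProjectiveEmbedding P.X) (a : complexBetti (projectiveSpace e.n ℂ) 2)
    (hP : P.dim = 2 * 2) (hψ : ψ₀ ≫ ψ₀ = -(d • 𝟙 P)) (ha : IsRationalClass a) (ha0 : a ≠ 0)
    (hhyp : IsHyperbolicWeilType P ψ₀ 2 (symmetrisedClass d P ψ₀ e a)) {w : complexBetti P.X (2 * 2)} {I : Finset ℕ}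
    (h2 : 2 ∈ I) (E : CochainComplex P.X.left.Modules ℤ) (hE : IsBoundedVBComplex E) (hAdm : rankAdmissible C (2 * 2) P.X I E)
    (hκ : IsMarkmanKappaShape 2 d P ψ₀ (symmetrisedClass d P ψ₀ e a) I (fun p ↦ chPerfect C P.X E hE.isFiniteLocallyFree p) w) :
    Stubs.WeilAlgebraicSplitHyperplane 2 d :=
  weilFourfoldsSplit_of_reach_of_perfectComplexVariationalHodge_of_isMarkmanKappaShape hF ((perfectComplexRankTransfer_iff C).1 hT)
    hd P ψ₀ e a hP hψ ha ha0 hhyp h2 E hE hAdm hκ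

end MarkmanShape

/-! ## Audit: nothing is decided here
Every theorem above carries a transfer assumption (`PerfectComplexVariationalHodge C Adm`, a schema in the admissibility notion `Adm`;
`PerfectComplexRankTransfer C` = the instance `Adm := rankAdmissible C` on real carriers; BF Thm. 5.1 for `bfAdmissible`) AND a seed
of the corresponding class (the cell's census object, by value) among its hypotheses, next to the refereed reach fact / the chart
clauses BY NAME. The kernel does not link any `Adm` to Pridham / Perry. `HC_CM`, CM density, Mumford–Tate finiteness do not occur.
No definition, no named fact. -/

end Summit.Ventures.HSemireg

end
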